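import Summits.QuantumFields.YangMills.Theorems.ColdStartUniversalityLatticeLangevinDossSussmannSmoothingPrep2
import HarnessLib

/-!
# Route `ColdStartUniversality` (fixed-cut-off SZZ dynamics; Doss–Sussmann smoothing programme, file 9a):
# SECOND-ORDER CHAIN RULE — NORM BOUNDS

Helper file (seat `ym-line-csu-p1`, g24).  Elementary calculus used to bound the second derivative of the integrand
`M ↦ f(B_t · Φ(R M))` uniformly in `ω`:
* `norm_clm_comp_deriv_le` — `‖compL(x) ∘ d' + compL.flip(y) ∘ c'‖ ≤ ‖x‖‖d'‖ + ‖y‖‖c'‖` (the product-rule derivative of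
  `y ↦ (c y).comp (d y)`, `HasFDerivAt.clm_comp`; `‖compL‖ ≤ 1`);
* `norm_fderiv_comp_le'` — `‖D(g ∘ h)(x)‖ ≤ ‖Dg(hx)‖ ‖Dh(x)‖`;
* ★ `norm_fderiv_fderiv_comp_le` — `‖D²(g ∘ h)(x)‖ ≤ ‖D²g(hx)‖ ‖Dh x‖² + ‖Dg(hx)‖ ‖D²h x‖` for `g`, `h` of class `C²`
  near the relevant points;
* `norm_fderiv_fderiv_clm_comp_le` — for a continuous linear `L`: `‖D²(L ∘ h)(x)‖ ≤ ‖L‖ ‖D²h(x)‖`.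
THEOREMS ONLY, no sorry.  HONEST FRAMING: plumbing; nothing K-uniform; no crux, rung or summit statement is proved; the
Yang–Mills mass gap is NOT proved.
-/

set_option autoImplicit false

noncomputable section

namespace Summit.QuantumFields.YangMills.Theorems.ColdStartUniversality

open Filter Set Metric Function
open scoped Topology

/-- Norm bound for the product-rule derivative of `y ↦ (c y).comp (d y)` (`HasFDerivAt.clm_comp`):
`‖compL(x) ∘ d' + compL.flip(y) ∘ c'‖ ≤ ‖x‖‖d'‖ + ‖y‖‖c'‖` (since `‖compL‖ ≤ 1`). [folklore] -/
theorem norm_clm_comp_deriv_le {X E F G : Type*} [NormedAddCommGroup X] [NormedSpace ℝ X]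
    [NormedAddCommGroup E] [NormedSpace ℝ E] [NormedAddCommGroup F] [NormedSpace ℝ F]
    [NormedAddCommGroup G] [NormedSpace ℝ G]
    (x : F →L[ℝ] G) (y : E →L[ℝ] F) (c' : X →L[ℝ] (F →L[ℝ] G)) (d' : X →L[ℝ] (E →L[ℝ] F)) :
    ‖((ContinuousLinearMap.compL ℝ E F G) x).comp d' + ((ContinuousLinearMap.compL ℝ E F G).flip y).comp c'‖ ≤
      ‖x‖ * ‖d'‖ + ‖y‖ * ‖c'‖ := by
  have h1 : ‖((ContinuousLinearMap.compL ℝ E F G) x).comp d'‖ ≤ ‖x‖ * ‖d'‖ := by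
    refine ContinuousLinearMap.opNorm_le_bound _ (by positivity) fun v => ?_
    rw [ContinuousLinearMap.comp_apply, ContinuousLinearMap.compL_apply, mul_assoc]
    exact (ContinuousLinearMap.opNorm_comp_le _ _).trans
      (mul_le_mul_of_nonneg_left (d'.le_opNorm v) (norm_nonneg x))
  have h2 : ‖((ContinuousLinearMap.compL ℝ E F G).flip y).comp c'‖ ≤ ‖y‖ * ‖c'‖ := by
    refine ContinuousLinearMap.opNorm_le_bound _ (by positivity) fun v => ?_
    rw [ContinuousLinearMap.comp_apply, ContinuousLinearMap.flip_apply, ContinuousLinearMap.compL_apply]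
    calc ‖(c' v).comp y‖ ≤ ‖c' v‖ * ‖y‖ := ContinuousLinearMap.opNorm_comp_le _ _
      _ ≤ (‖c'‖ * ‖v‖) * ‖y‖ := mul_le_mul_of_nonneg_right (c'.le_opNorm v) (norm_nonneg y)
      _ = ‖y‖ * ‖c'‖ * ‖v‖ := by ring
  exact (norm_add_le _ _).trans (add_le_add h1 h2)

/-- First-order chain rule bound `‖D(g ∘ h)(x)‖ ≤ ‖Dg(h x)‖ ‖Dh(x)‖`. [folklore] -/
theorem norm_fderiv_comp_le' {X Y Z : Type*} [NormedAddCommGroup X] [NormedSpace ℝ X]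
    [NormedAddCommGroup Y] [NormedSpace ℝ Y] [NormedAddCommGroup Z] [NormedSpace ℝ Z]
    {g : Y → Z} {h : X → Y} {x : X} (hg : DifferentiableAt ℝ g (h x)) (hh : DifferentiableAt ℝ h x) :
    ‖fderiv ℝ (g ∘ h) x‖ ≤ ‖fderiv ℝ g (h x)‖ * ‖fderiv ℝ h x‖ := by
  rw [fderiv_comp x hg hh]
  exact ContinuousLinearMap.opNorm_comp_le _ _

/-- ★ **Second-order chain rule bound.**  If `g` is `C²` at `h x` and `h` is `C²` at `x` then
`‖D²(g ∘ h)(x)‖ ≤ ‖D²g(h x)‖ ‖Dh(x)‖² + ‖Dg(h x)‖ ‖D²h(x)‖`. [folklore] -/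
theorem norm_fderiv_fderiv_comp_le {X Y Z : Type*} [NormedAddCommGroup X] [NormedSpace ℝ X]
    [NormedAddCommGroup Y] [NormedSpace ℝ Y] [NormedAddCommGroup Z] [NormedSpace ℝ Z]
    {g : Y → Z} {h : X → Y} {x : X} (hg : ContDiffAt ℝ 2 g (h x)) (hh : ContDiffAt ℝ 2 h x) :
    ‖fderiv ℝ (fderiv ℝ (g ∘ h)) x‖ ≤
      ‖fderiv ℝ (fderiv ℝ g) (h x)‖ * ‖fderiv ℝ h x‖ ^ 2 + ‖fderiv ℝ g (h x)‖ * ‖fderiv ℝ (fderiv ℝ h) x‖ := by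
  have h2ne : (2 : WithTop ℕ∞) ≠ ((⊤ : ℕ∞) : WithTop ℕ∞) := by
    rw [show (2 : WithTop ℕ∞) = ((2 : ℕ∞) : WithTop ℕ∞) by norm_cast]
    exact fun h => ENat.coe_ne_top 2 (WithTop.coe_eq_coe.1 h)
  -- differentiability near the points
  have hg1 : ContDiffAt ℝ 1 (fderiv ℝ g) (h x) := hg.fderiv_right (m := 1) le_rfl
  have hh1 : ContDiffAt ℝ 1 (fderiv ℝ h) x := hh.fderiv_right (m := 1) le_rfl
  have hgd : DifferentiableAt ℝ (fderiv ℝ g) (h x) := hg1.differentiableAt one_ne_zero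
  have hhd : DifferentiableAt ℝ (fderiv ℝ h) x := hh1.differentiableAt one_ne_zero
  have hhc : ContinuousAt h x := hh.continuousAt
  have hev_h : ∀ᶠ y in 𝓝 x, DifferentiableAt ℝ h y :=
    (hh.eventually h2ne).mono fun y hy => hy.differentiableAt two_ne_zero
  have hev_g : ∀ᶠ y in 𝓝 x, DifferentiableAt ℝ g (h y) :=
    hhc.eventually ((hg.eventually h2ne).mono fun z hz => hz.differentiableAt two_ne_zero)
  -- the first derivative near `x`
  have hev : fderiv ℝ (g ∘ h) =ᶠ[𝓝 x] fun y => (fderiv ℝ g (h y)).comp (fderiv ℝ h y) := by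
    filter_upwards [hev_h, hev_g] with y hy hgy
    exact fderiv_comp y hgy hy
  rw [hev.fderiv_eq]
  -- differentiate the product
  have hc : HasFDerivAt (fun y => fderiv ℝ g (h y)) ((fderiv ℝ (fderiv ℝ g) (h x)).comp (fderiv ℝ h x)) x :=
    hgd.hasFDerivAt.comp x (hh.differentiableAt two_ne_zero).hasFDerivAt
  have hd : HasFDerivAt (fun y => fderiv ℝ h y) (fderiv ℝ (fderiv ℝ h) x) x := hhd.hasFDerivAt
  rw [(hc.clm_comp hd).fderiv]
  refine (norm_clm_comp_deriv_le _ _ _ _).trans ?_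
  have h3 : ‖(fderiv ℝ (fderiv ℝ g) (h x)).comp (fderiv ℝ h x)‖ ≤ ‖fderiv ℝ (fderiv ℝ g) (h x)‖ * ‖fderiv ℝ h x‖ :=
    ContinuousLinearMap.opNorm_comp_le _ _
  calc ‖fderiv ℝ g (h x)‖ * ‖fderiv ℝ (fderiv ℝ h) x‖ +
        ‖fderiv ℝ h x‖ * ‖(fderiv ℝ (fderiv ℝ g) (h x)).comp (fderiv ℝ h x)‖
      ≤ ‖fderiv ℝ g (h x)‖ * ‖fderiv ℝ (fderiv ℝ h) x‖ +
        ‖fderiv ℝ h x‖ * (‖fderiv ℝ (fderiv ℝ g) (h x)‖ * ‖fderiv ℝ h x‖) := by gcongr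
    _ = ‖fderiv ℝ (fderiv ℝ g) (h x)‖ * ‖fderiv ℝ h x‖ ^ 2 + ‖fderiv ℝ g (h x)‖ * ‖fderiv ℝ (fderiv ℝ h) x‖ := by
        ring

/-- Post-composition with a continuous linear map: `‖D²(L ∘ h)(x)‖ ≤ ‖L‖ ‖D²h(x)‖`. [folklore] -/
theorem norm_fderiv_fderiv_clm_comp_le {X Y Z : Type*} [NormedAddCommGroup X] [NormedSpace ℝ X]
    [NormedAddCommGroup Y] [NormedSpace ℝ Y] [NormedAddCommGroup Z] [NormedSpace ℝ Z]
    (L : Y →L[ℝ] Z) {h : X → Y} {x : X} (hh : ContDiffAt ℝ 2 h x) :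
    ‖fderiv ℝ (fderiv ℝ (fun y => L (h y))) x‖ ≤ ‖L‖ * ‖fderiv ℝ (fderiv ℝ h) x‖ := by
  have hmain := norm_fderiv_fderiv_comp_le (g := fun y => L y) (h := h) (x := x) L.contDiff.contDiffAt hh
  have h0 : fderiv ℝ (fderiv ℝ fun y : Y => L y) (h x) = 0 := by
    have : (fderiv ℝ fun y : Y => L y) = fun _ => L := by funext y; exact L.fderiv
    rw [this, fderiv_const_apply]
  rw [h0, ContinuousLinearMap.opNorm_zero, zero_mul, zero_add, L.fderiv] at hmain
  exact hmain

end Summit.QuantumFields.YangMills.Theorems.ColdStartUniversality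

end
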